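import Summits.Ventures.HSemireg.TwoLevelObstructionFactorisation
import Literature.AlgebraicGeometry.HodgeTheory.AtiyahClassConnecting
import HarnessLib

/-!
# Venture HSemireg — THEOREM P for `ob_κ = At ≫ c_κ` with the TREE'S Atiyah class: the `a`-squares discharged

HONEST FRAMING. Lean side of the computation cell `pub-hsemireg` (S4-PUSH, H2 door PAD-4; seat s4-prove-1 g28,
2026-08-28; TIER-3, piece B2(a) of the MODEL-TO-SHEAF BRIDGE of row 716 sized in
`s4push/prove-1/TIER3-SIZING-ModelToSheafBridge-prove-1-g25.md`). `TwoLevelObstructionFactorisation.lean` (B1, p600898)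
proves THEOREM P's necessity step for any obstruction datum `NaturalAlong S` and builds such a datum from SIX primitive
squares for a composite `ob = a ≫ c` (`NaturalAlong.ofComposite`). Here `a` IS the tree's torsion-safe Atiyah class
`atiyahClass' F ∈ Ext¹(F, 𝓗om(𝒯, F))` (`Literature.AlgebraicGeometry.HodgeTheory.AtiyahClassCoherent`), on the modules of
an `S`-scheme `X : Over (Spec k)`, and its three squares are THEOREMS of the tree:
`atiyahClass'_naturality` (along `φ` and `g`; `AtiyahClassCoherentNaturality.lean`) and
`extClass_comp_atiyahClass'_eq_units_smul` (along the connecting classes, sign `−1`; `AtiyahClassConnecting.lean`,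
this seat). What REMAINS a hypothesis is the contraction `c`: a `Contraction X q` below is a family
`c(F) ∈ Ext^q(𝓗om(𝒯, F), F)` natural along module maps (for `ob_κ = κ ∪ At`, `q = 1` and `c(F) = κ ⊗ id` followed by
evaluation, `κ ∈ H¹(X, 𝒯)` — NOT constructed here), together with ONE square `comm_δ` along the connecting classes
of the given sequence. RESULTS:

* `Contraction.ob κ F := At'(F) ≫ c(F) ∈ Extⁿ(F, F)` (`1 + q = n`) is natural along every module map
  (`Contraction.ob_natural`);
* `NaturalAlong.ofContraction` — for a short exact `S` with `𝓗om(𝒯, S)` short exact and the square `comm_δ` for `c`,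
  `ob` is an obstruction datum natural along `S` (sign `ε = −εc`); hence THEOREM P both levels
  (`Contraction.exists_lower_and_upper`: `ob(E) = 0 ⇒ ∃ η, η ∘ φ = ob(E₋)` and `∃ η′, φ ∘ η′ = ob(E₊)`);
* `OnDesign.ofContraction` ∕ `Contraction.design_lower_and_upper` — on a two-level design `0 → ⨁ P →φ ⨁ N →g E → 0`
  the naturality along the biproduct injections is AUTOMATIC (`ob_natural`), so `ob(E) = 0` gives row 716's shapes
  `LowerColumnSolvable` (every column, all rows) and `UpperRowSolvable` (every row object, all rows) — B1's
  `OnDesign.lower_and_upper` with every `a`-input discharged.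

So the bridge sentence «ob_κ(E) = 0 ⇒ 716 `H2` at κ» now rests on: (c) a natural contraction with its ONE connecting
square (paper: `κ ∪ −` is a morphism of functors), (B3) the Künneth–Leray frame identifying these `Ext`-groups with row
716's coordinates, (B4) `ob_κ(L) = (κ ∪ c₁ L)` on line bundles — all NOT here. Generic in the scheme; no variety, no
torus, no Hodge class is mentioned; no Literature FACT (`def … : Prop`) is declared or used; no instance, no notation;
census-neutral. NOTHING HERE SAYS THAT HC ∕ HC_CM ∕ HC_AV ∕ W₆ ∕ HC_Kum4Type HOLDS OR FAILS, and nothing here is a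
statement about `stub_rung_pad4_seedAt`; `theoremLZeta_holds` stays a theorem of the first-order MODEL.
-/

noncomputable section
namespace Summit.Ventures.HSemireg.TwoLevelObstruction

open CategoryTheory CategoryTheory.Abelian CategoryTheory.Limits AlgebraicGeometry
open Literature.AlgebraicGeometry.HodgeTheory Literature.AlgebraicGeometry.Modules
  Literature.AlgebraicGeometry.Motives

universe w u

variable {k : Type u} [CommRing k] {X : Over (Spec (CommRingCat.of k))} [HasExt.{w} X.left.Modules]

/-! ## §1 Natural contractions and the composite obstruction `ob = At' ≫ c` -/

variable (X) in
/-- A degree-`q` **contraction**: classes `c(F) ∈ Ext^q(𝓗om(𝒯, F), F)` for every `𝒪_X`-module `F`, natural along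
module maps `f : F → G` (`c(F) ∘ f = 𝓗om(𝒯, f) ∘ c(G)`, diagrammatic order). For `ob_κ = κ ∪ At` this is
`q = 1`, `c(F) =` contraction with `κ ∈ H¹(X, 𝒯)`; that instance is NOT constructed in the tree — the structure is a
hypothesis. [definition of this file] -/
structure Contraction (q : ℕ) where
  /-- the class `c(F) ∈ Ext^q(𝓗om(𝒯, F), F)`. -/
  c : ∀ F : X.left.Modules, Ext.{w} (twistTangentHom F) F q
  /-- naturality along module maps. -/
  comm : ∀ {F G : X.left.Modules} (f : F ⟶ G),
    (c F).comp (Ext.mk₀ f) (add_zero q) = (Ext.mk₀ (sheafHomMap (tangentSheaf X) f)).comp (c G) (zero_add q)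

namespace Contraction

variable {q n : ℕ} (κ : Contraction.{w} X q) (h : 1 + q = n)

/-- **The composite obstruction** `ob(F) := At'(F) ≫ c(F) ∈ Extⁿ(F, F)` (`n = 1 + q`; for `ob_κ = κ ∪ At`, `n = 2`).
[definition of this file] -/
def ob (F : X.left.Modules) : Ext.{w} F F n :=
  (atiyahClass'.{w} F).comp (κ.c F) h

/-- `ob` is natural along every module map: `f ≫ ob(G) = ob(F) ≫ f` — from `atiyahClass'_naturality` (tree) and
`Contraction.comm` (hypothesis), via B1's `comp_natural₀`. -/
theorem ob_natural {F G : X.left.Modules} (f : F ⟶ G) :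
    (Ext.mk₀ f).comp (κ.ob h G) (zero_add n) = (κ.ob h F).comp (Ext.mk₀ f) (add_zero n) :=
  comp_natural₀ f (sheafHomMap (tangentSheaf X) f) (atiyahClass' F) (atiyahClass' G) (κ.c F) (κ.c G) h
    (atiyahClass'_naturality f) (κ.comm f)

end Contraction

/-! ## §2 One short exact sequence: the datum natural along `S`, THEOREM P both levels -/

section OneSequence

variable {S : ShortComplex X.left.Modules} {q n : ℕ}

/-- **The obstruction datum of `ob = At' ≫ c` along a short exact `S`** whose twist `𝓗om(𝒯, S)` is short exact,
given ONE more square for `c`: along the connecting classes, `[𝓗om(𝒯, S)] ∘ c(E₊) = εc • c(E) ∘ [S]`. The three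
`a`-squares are the tree's `atiyahClass'_naturality` (×2) and `extClass_comp_atiyahClass'_eq_units_smul` (sign `−1`);
the resulting sign is `ε = −εc`. [construction of this file, on B1's `NaturalAlong.ofComposite`] -/
def NaturalAlong.ofContraction (hS : S.ShortExact) (hTS : (S.map (sheafHomFunctor (tangentSheaf X))).ShortExact)
    (κ : Contraction.{w} X q) (h : 1 + q = n) (εc : ℤˣ)
    (hcδ : (twistedExtClass hTS).comp (κ.c S.X₁) (add_comm 1 q) = (εc : ℤ) • (κ.c S.X₃).comp hS.extClass rfl) :
    NaturalAlong hS n :=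
  NaturalAlong.ofComposite hS h (sheafHomMap (tangentSheaf X) S.f) (sheafHomMap (tangentSheaf X) S.g)
    (twistedExtClass hTS) (atiyahClass' S.X₁) (atiyahClass' S.X₂) (atiyahClass' S.X₃) (κ.c S.X₁) (κ.c S.X₂)
    (κ.c S.X₃) (-1) εc (atiyahClass'_naturality S.f) (κ.comm S.f) (atiyahClass'_naturality S.g) (κ.comm S.g)
    (extClass_comp_atiyahClass'_eq_units_smul hS hTS _) hcδ

/-- Its three obstructions are `ob(E₊), ob(E₋), ob(E)`. -/
theorem NaturalAlong.ofContraction_ω (hS : S.ShortExact)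
    (hTS : (S.map (sheafHomFunctor (tangentSheaf X))).ShortExact) (κ : Contraction.{w} X q) (h : 1 + q = n)
    (εc : ℤˣ) (hcδ) :
    (NaturalAlong.ofContraction hS hTS κ h εc hcδ).ω₁ = κ.ob h S.X₁ ∧
      (NaturalAlong.ofContraction hS hTS κ h εc hcδ).ω₂ = κ.ob h S.X₂ ∧
        (NaturalAlong.ofContraction hS hTS κ h εc hcδ).ω₃ = κ.ob h S.X₃ :=
  ⟨rfl, rfl, rfl⟩

/-- Its sign is `−εc`. -/
theorem NaturalAlong.ofContraction_ε (hS : S.ShortExact)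
    (hTS : (S.map (sheafHomFunctor (tangentSheaf X))).ShortExact) (κ : Contraction.{w} X q) (h : 1 + q = n)
    (εc : ℤˣ) (hcδ) :
    (NaturalAlong.ofContraction hS hTS κ h εc hcδ).ε = -εc := by
  change (-1 : ℤˣ) * εc = -εc
  rw [neg_one_mul]

/-- **THEOREM P, both levels, for `ob = At' ≫ c`**: if `ob(E) = 0` then `ob(E₋)` factors through the presentation
(`∃ η, η ∘ φ = ob(E₋)`) and `ob(E₊)` lifts along `φ^*` (`∃ η′, φ ∘ η′ = ob(E₊)`). Inputs beyond the tree: the natural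
contraction `κ` and its connecting square `hcδ`. -/
theorem Contraction.exists_lower_and_upper (hS : S.ShortExact)
    (hTS : (S.map (sheafHomFunctor (tangentSheaf X))).ShortExact) (κ : Contraction.{w} X q) (h : 1 + q = n)
    (εc : ℤˣ)
    (hcδ : (twistedExtClass hTS).comp (κ.c S.X₁) (add_comm 1 q) = (εc : ℤ) • (κ.c S.X₃).comp hS.extClass rfl)
    (h0 : κ.ob h S.X₃ = 0) :
    (∃ η : Ext S.X₂ S.X₁ n, η.comp (Ext.mk₀ S.f) (add_zero n) = κ.ob h S.X₂) ∧
      ∃ η' : Ext S.X₂ S.X₁ n, (Ext.mk₀ S.f).comp η' (zero_add n) = κ.ob h S.X₁ :=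
  (NaturalAlong.ofContraction hS hTS κ h εc hcδ).exists_lower_and_upper h0

end OneSequence

/-! ## §3 Two-level designs: row 716's `LowerColumnSolvable` ∕ `UpperRowSolvable` shapes from `ob(E) = 0` -/

section TwoLevel

variable [HasFiniteBiproducts X.left.Modules]
variable {I J : Type} [Fintype I] [Fintype J]
variable {N : I → X.left.Modules} {P : J → X.left.Modules} {E : X.left.Modules} {q n : ℕ}
variable {φ : ⨁ P ⟶ ⨁ N} {g : ⨁ N ⟶ E} {w : φ ≫ g = 0}

/-- **The obstruction datum of `ob = At' ≫ c` on a two-level design** `0 → ⨁ P →φ ⨁ N →g E → 0`: the naturality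
along the biproduct injections required by B1's `OnDesign` is AUTOMATIC for a natural contraction (`ob_natural`);
inputs beyond the tree: `κ` and its ONE connecting square. [construction of this file] -/
def OnDesign.ofContraction (hS : (ShortComplex.mk φ g w).ShortExact)
    (hTS : ((ShortComplex.mk φ g w).map (sheafHomFunctor (tangentSheaf X))).ShortExact)
    (κ : Contraction.{w} X q) (h : 1 + q = n) (εc : ℤˣ)
    (hcδ : (twistedExtClass hTS).comp (κ.c (⨁ P)) (add_comm 1 q) = (εc : ℤ) • (κ.c E).comp hS.extClass rfl) :
    OnDesign hS n where
  toNaturalAlong := NaturalAlong.ofContraction hS hTS κ h εc hcδ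
  ωN i := κ.ob h (N i)
  ωP j := κ.ob h (P j)
  comm_ιN i := κ.ob_natural h (biproduct.ι N i)
  comm_ιP j := κ.ob_natural h (biproduct.ι P j)

/-- **Row 716's `Design.H2` SHAPE at one direction is NECESSARY for `ob(E) = 0`, with the Atiyah inputs discharged**:
for a natural contraction `κ` with its connecting square on the design sequence, `ob(E) = At'(E) ≫ c(E) = 0` implies —
for every column `N i`: `∃ η_j ∈ Extⁿ(N i, P j)` with `Σ_j η_j ∘ φ_{ij} = ob(N i)` and `Σ_j η_j ∘ φ_{rj} = 0` (`r ≠ i`);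
and for every row object `P j`: `∃ η′_i` with `Σ_i φ_{ij} ∘ η′_i = ob(P j)` and `Σ_i φ_{is} ∘ η′_i = 0` (`s ≠ j`).
What is still hypothesis: `κ` (contraction with a class in `H¹(X, 𝒯)`, natural) and `hcδ`; what is still paper for
the bridge: the Künneth–Leray frame (B3) and `ob` on line bundles (B4). -/
theorem Contraction.design_lower_and_upper (hS : (ShortComplex.mk φ g w).ShortExact)
    (hTS : ((ShortComplex.mk φ g w).map (sheafHomFunctor (tangentSheaf X))).ShortExact)
    (κ : Contraction.{w} X q) (h : 1 + q = n) (εc : ℤˣ)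
    (hcδ : (twistedExtClass hTS).comp (κ.c (⨁ P)) (add_comm 1 q) = (εc : ℤ) • (κ.c E).comp hS.extClass rfl)
    (h0 : κ.ob h E = 0) :
    (∀ i, ∃ η : ∀ j, Ext (N i) (P j) n,
      (∑ j, (η j).comp (Ext.mk₀ (entry φ i j)) (add_zero n) = κ.ob h (N i)) ∧
        ∀ r, i ≠ r → ∑ j, (η j).comp (Ext.mk₀ (entry φ r j)) (add_zero n) = 0) ∧
    ∀ j, ∃ η' : ∀ i, Ext (N i) (P j) n,
      (∑ i, (Ext.mk₀ (entry φ i j)).comp (η' i) (zero_add n) = κ.ob h (P j)) ∧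
        ∀ s, s ≠ j → ∑ i, (Ext.mk₀ (entry φ i s)).comp (η' i) (zero_add n) = 0 :=
  (OnDesign.ofContraction hS hTS κ h εc hcδ).lower_and_upper h0

end TwoLevel

end Summit.Ventures.HSemireg.TwoLevelObstruction

end
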